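import Mathlib
import HarnessLib
import Literature.Analysis.FluidPDE.SelfSimilar
import Literature.Analysis.FluidPDE.TypeIAncientMild
import Literature.Analysis.FluidPDE.KNSSLocalSmoothingHolds
import Literature.Analysis.FluidPDE.OseenMildUniqueness
import Literature.Analysis.FluidPDE.ClassicalSupStabilityMild
import Literature.Analysis.FluidPDE.NSBoundedMildSmoothing
import Literature.Analysis.FluidPDE.ClassicalSolutionGlue
import Literature.Analysis.FluidPDE.ForcedOseenRepresentationClassical
import Literature.Analysis.FluidPDE.ClassicalNSBlowupAlternative
import Literature.Analysis.FluidPDE.BoundedMildSpatialDecay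
import Literature.Analysis.FluidPDE.UlocKernelEstimates
import Summits.NavierStokesRegularity.NavierStokesRegularity.Theorems.QuarterLogPincerThinCascadeDefs
import Summits.NavierStokesRegularity.NavierStokesRegularity.Theorems.QuarterLogPincerTruncationEdgeAnatomyDefs

/-!
# Crux `QuarterLogPincer.TypeIQuantSubcubicExp` (stmt-NavierStokesRegularity-24077), EDGE line `truncation_edge` (ns-idea-7 g8/g9):
# helpers for P3b′ (the dyadic-radius bootstrap) — author's v1.8 section, VERBATIM

Tree copy of the AUTHOR'S helper lemmas (ns-idea-7 g9, workfile `Cruxes/TypeIQuantSubcubicExp/Lines/truncation_edge.lean` v1.8, section «helpers for the dyadic-radius bootstrap» + «Part 1: two-region Oseen estimates»: `forall_norm_le_of_ae_norm_le_on'`, `setIntegral_rate_le`, `volume_real_ball_eq`), re-homed by the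
pub-ns-dss typer (g35; `--supports stmt-NavierStokesRegularity-24077`, helper) for the by-name landing of P3b′
(`…TruncationEdgeSupShadowingProfile`).  Credit: ns-idea-7 g9.  HONEST FRAME: calculus helpers; nothing about NS regularity.
-/

noncomputable section

set_option linter.dupNamespace false

namespace Summit.NavierStokesRegularity.NavierStokesRegularity.Cruxes.TypeIQuantSubcubicExp.TruncationEdge

open MeasureTheory Set Function Metric Filter Topology
open scoped ENNReal NNReal
open Literature.Analysis Literature.Analysis.FluidPDE
open Summit.NavierStokesRegularity.NavierStokesRegularity.Cruxes.TypeIQuantSubcubicExp.ThinCascade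

/-! ### v1.8 — P3b′ PROVED.  Part 1: two-region Oseen estimates (no measurability needed) -/

/-- **Two-region slice bound.**  If `‖a(y)‖‖b(y)‖ ≤ P` on the ball `‖y‖ < R₀` and `‖a‖ ≤ Ma`,
`‖b‖ ≤ Mb` off it, then at a point `x` with `‖x‖ ≥ R₀ + R₁`, `R₁ ≥ 1`, the Oseen slice satisfies
`‖N_σ[a,b](x)‖ ≤ C P |B(R₀)| R₁^{-4} + C I Ma Mb σ^{-1/2}` — near sources see the kernel decay
`(σ+|z|²)^{-2} ≤ R₁^{-4}`, far sources the `L¹` slice bound.  Here `C` is the kernel constant of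
`exists_norm_oseenKernel_le` and `I = ∫ (1+‖w‖²)^{-2}`. [folklore] -/
theorem norm_oseenSlice_two_region {C : ℝ} (hC : 0 < C)
    (hK : ∀ {τ : ℝ}, 0 < τ → ∀ z a b : EuclideanSpace ℝ (Fin 3),
      ‖oseenKernel τ z a b‖ ≤ C * (τ + ‖z‖ ^ 2) ^
        (-(((Module.finrank ℝ (EuclideanSpace ℝ (Fin 3)) : ℝ) + 1) / 2)) * ‖a‖ * ‖b‖)
    {σ R₀ R₁ P Ma Mb : ℝ} (hσ : 0 < σ) (_hR₀ : 0 ≤ R₀) (hR₁ : 1 ≤ R₁) (_hP : 0 ≤ P) (hMa : 0 ≤ Ma)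
    (hMb : 0 ≤ Mb) {a b : EuclideanSpace ℝ (Fin 3) → EuclideanSpace ℝ (Fin 3)}
    (hnear : ∀ y, ‖y‖ < R₀ → ‖a y‖ * ‖b y‖ ≤ P)
    (hfa : ∀ y, R₀ ≤ ‖y‖ → ‖a y‖ ≤ Ma) (hfb : ∀ y, R₀ ≤ ‖y‖ → ‖b y‖ ≤ Mb)
    {x : EuclideanSpace ℝ (Fin 3)} (hx : R₀ + R₁ ≤ ‖x‖) :
    ‖oseenSlice σ a b x‖ ≤
      C * P * volume.real (Metric.ball (0 : EuclideanSpace ℝ (Fin 3)) R₀) * R₁ ^ (-(4 : ℝ)) +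
      C * (∫ w : EuclideanSpace ℝ (Fin 3), (1 + ‖w‖ ^ 2) ^
          (-(((Module.finrank ℝ (EuclideanSpace ℝ (Fin 3)) : ℝ) + 1) / 2))) * Ma * Mb *
        σ ^ (-(1 / 2 : ℝ)) := by
  set e : ℝ := ((Module.finrank ℝ (EuclideanSpace ℝ (Fin 3)) : ℝ) + 1) / 2 with he_def
  have he : e = 2 := oseen_exponent_eq_two
  set I : ℝ := ∫ w : EuclideanSpace ℝ (Fin 3), (1 + ‖w‖ ^ 2) ^ (-e) with hI_def
  set Bn : Set (EuclideanSpace ℝ (Fin 3)) := Metric.ball 0 R₀ with hBn_def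
  have hBm : MeasurableSet Bn := measurableSet_ball
  have hBfin : volume Bn < ⊤ := measure_ball_lt_top
  -- the majorant
  set h : EuclideanSpace ℝ (Fin 3) → ℝ := fun y =>
    Bn.indicator (fun _ => C * P * R₁ ^ (-(4 : ℝ))) y + C * Ma * Mb * (σ + ‖x - y‖ ^ 2) ^ (-e)
    with hh_def
  have hwint : Integrable (fun y : EuclideanSpace ℝ (Fin 3) => C * Ma * Mb * (σ + ‖x - y‖ ^ 2) ^ (-e)) :=
    ((integrable_add_norm_sq_rpow_neg_half_succ (E := EuclideanSpace ℝ (Fin 3)) hσ).comp_sub_left x).const_mul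
      (C * Ma * Mb)
  have hind : Integrable (Bn.indicator fun _ : EuclideanSpace ℝ (Fin 3) => C * P * R₁ ^ (-(4 : ℝ))) := by
    refine IntegrableOn.integrable_indicator ?_ hBm
    exact integrableOn_const hBfin.ne
  have hhint : Integrable h := hind.add hwint
  -- pointwise bound of the kernel integrand
  have hR₁pos : 0 < R₁ := by linarith
  have hptw : ∀ y, ‖oseenKernel σ (x - y) (a y) (b y)‖ ≤ h y := by
    intro y
    have hk := hK hσ (x - y) (a y) (b y)
    have hw0 : 0 ≤ C * (σ + ‖x - y‖ ^ 2) ^ (-e) := by positivity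
    by_cases hy : ‖y‖ < R₀
    · -- near source: kernel decay
      have hyB : y ∈ Bn := by rw [hBn_def]; exact mem_ball_zero_iff.2 hy
      have hdist : R₁ ≤ ‖x - y‖ := by linarith [norm_sub_norm_le x y, hy.le, hx, hR₁]
      have hker : (σ + ‖x - y‖ ^ 2) ^ (-e) ≤ R₁ ^ (-(4 : ℝ)) := by
        have h1 : R₁ ^ 2 ≤ σ + ‖x - y‖ ^ 2 := by nlinarith
        calc (σ + ‖x - y‖ ^ 2) ^ (-e) ≤ (R₁ ^ 2) ^ (-e) :=
              Real.rpow_le_rpow_of_nonpos (by positivity) h1 (by rw [he]; norm_num)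
          _ = R₁ ^ (-(4 : ℝ)) := by
              rw [he, ← Real.rpow_natCast, ← Real.rpow_mul hR₁pos.le]; norm_num
      have hab := hnear y hy
      calc ‖oseenKernel σ (x - y) (a y) (b y)‖
          ≤ C * (σ + ‖x - y‖ ^ 2) ^ (-e) * ‖a y‖ * ‖b y‖ := hk
        _ = C * (σ + ‖x - y‖ ^ 2) ^ (-e) * (‖a y‖ * ‖b y‖) := by ring
        _ ≤ C * R₁ ^ (-(4 : ℝ)) * P := by
            have := mul_le_mul hker hab (by positivity) (by positivity)
            nlinarith [this, hC.le]
        _ ≤ h y := by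
            rw [hh_def]; simp only [indicator_of_mem hyB]
            have : 0 ≤ C * Ma * Mb * (σ + ‖x - y‖ ^ 2) ^ (-e) := by positivity
            have h2 : C * R₁ ^ (-(4 : ℝ)) * P = C * P * R₁ ^ (-(4 : ℝ)) := by ring
            linarith [this, h2]
    · -- far source: sup bounds
      have hy' : R₀ ≤ ‖y‖ := not_lt.1 hy
      have hyB : y ∉ Bn := by rw [hBn_def, mem_ball_zero_iff]; exact hy
      calc ‖oseenKernel σ (x - y) (a y) (b y)‖
          ≤ C * (σ + ‖x - y‖ ^ 2) ^ (-e) * ‖a y‖ * ‖b y‖ := hk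
        _ ≤ C * (σ + ‖x - y‖ ^ 2) ^ (-e) * Ma * Mb := by
            have := mul_le_mul (hfa y hy') (hfb y hy') (norm_nonneg _) hMa
            calc C * (σ + ‖x - y‖ ^ 2) ^ (-e) * ‖a y‖ * ‖b y‖
                = C * (σ + ‖x - y‖ ^ 2) ^ (-e) * (‖a y‖ * ‖b y‖) := by ring
              _ ≤ C * (σ + ‖x - y‖ ^ 2) ^ (-e) * (Ma * Mb) := mul_le_mul_of_nonneg_left this hw0
              _ = C * (σ + ‖x - y‖ ^ 2) ^ (-e) * Ma * Mb := by ring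
        _ = h y := by
            rw [hh_def]; simp only [indicator_of_notMem hyB]; ring
  -- integrate the majorant
  rw [oseenSlice_apply]
  refine (norm_integral_le_of_norm_le hhint (Eventually.of_forall hptw)).trans (le_of_eq ?_)
  rw [hh_def]
  rw [integral_add hind hwint, integral_indicator hBm, setIntegral_const, integral_const_mul]
  have hW := integral_sub_left_eq_self (fun z : EuclideanSpace ℝ (Fin 3) => (σ + ‖z‖ ^ 2) ^ (-e)) volume x
  rw [hW, integral_add_norm_sq_rpow_neg_half_succ hσ]
  simp only [smul_eq_mul, Measure.real]
  ring

/-- **Two-region Duhamel bound.**  With near products `‖a(τ,y)‖‖b(τ,y)‖ ≤ P(τ)` on `‖y‖ < R₀`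
(`P ≥ 0` integrable on `(0,t)`) and far sup bounds `Ma`, `Mb`, at `‖x‖ ≥ R₀ + R₁` (`R₁ ≥ 1`):
`‖B¹_0(a,b)(t)(x)‖ ≤ C |B(R₀)| R₁^{-4} ∫_0^t P + 2 C I Ma Mb √t`. [folklore] -/
theorem norm_oseenDuhamel_two_region {C : ℝ} (hC : 0 < C)
    (hK : ∀ {τ : ℝ}, 0 < τ → ∀ z a b : EuclideanSpace ℝ (Fin 3),
      ‖oseenKernel τ z a b‖ ≤ C * (τ + ‖z‖ ^ 2) ^
        (-(((Module.finrank ℝ (EuclideanSpace ℝ (Fin 3)) : ℝ) + 1) / 2)) * ‖a‖ * ‖b‖)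
    {t R₀ R₁ Ma Mb : ℝ} (ht : 0 < t) (hR₀ : 0 ≤ R₀) (hR₁ : 1 ≤ R₁) (hMa : 0 ≤ Ma) (hMb : 0 ≤ Mb)
    {P : ℝ → ℝ} (hPi : IntegrableOn P (Ioo 0 t)) (hP0 : ∀ τ ∈ Ioo 0 t, 0 ≤ P τ)
    {a b : ℝ → EuclideanSpace ℝ (Fin 3) → EuclideanSpace ℝ (Fin 3)}
    (hnear : ∀ τ ∈ Ioo 0 t, ∀ y, ‖y‖ < R₀ → ‖a τ y‖ * ‖b τ y‖ ≤ P τ)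
    (hfa : ∀ τ ∈ Ioo 0 t, ∀ y, R₀ ≤ ‖y‖ → ‖a τ y‖ ≤ Ma)
    (hfb : ∀ τ ∈ Ioo 0 t, ∀ y, R₀ ≤ ‖y‖ → ‖b τ y‖ ≤ Mb)
    {x : EuclideanSpace ℝ (Fin 3)} (hx : R₀ + R₁ ≤ ‖x‖) :
    ‖oseenDuhamel 1 0 a b t x‖ ≤
      C * volume.real (Metric.ball (0 : EuclideanSpace ℝ (Fin 3)) R₀) * R₁ ^ (-(4 : ℝ)) *
          (∫ τ in Ioo 0 t, P τ) +
      C * (∫ w : EuclideanSpace ℝ (Fin 3), (1 + ‖w‖ ^ 2) ^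
          (-(((Module.finrank ℝ (EuclideanSpace ℝ (Fin 3)) : ℝ) + 1) / 2))) * Ma * Mb *
        (2 * Real.sqrt t) := by
  set I : ℝ := ∫ w : EuclideanSpace ℝ (Fin 3), (1 + ‖w‖ ^ 2) ^
    (-(((Module.finrank ℝ (EuclideanSpace ℝ (Fin 3)) : ℝ) + 1) / 2)) with hI_def
  set Vb : ℝ := volume.real (Metric.ball (0 : EuclideanSpace ℝ (Fin 3)) R₀) with hVb_def
  -- the majorant in time
  set m : ℝ → ℝ := fun τ => C * Vb * R₁ ^ (-(4 : ℝ)) * P τ +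
    C * I * Ma * Mb * (t - τ) ^ (-(1 / 2 : ℝ)) with hm_def
  have hk : IntegrableOn (fun τ : ℝ => (t - τ) ^ (-(1 / 2 : ℝ))) (Ioo 0 t) :=
    integrableOn_sub_rpow_Ioo (by norm_num)
  have hmi : IntegrableOn m (Ioo 0 t) := (hPi.const_mul _).add (hk.const_mul _)
  have hptw : ∀ᵐ τ ∂(volume.restrict (Ioo 0 t)), ‖oseenSlice (t - τ) (a τ) (b τ) x‖ ≤ m τ := by
    filter_upwards [ae_restrict_mem measurableSet_Ioo] with τ hτ
    have hσ : 0 < t - τ := by linarith [hτ.2]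
    have h := norm_oseenSlice_two_region hC hK hσ hR₀ hR₁ (hP0 τ hτ) hMa hMb (hnear τ hτ) (hfa τ hτ)
      (hfb τ hτ) hx
    rw [hm_def]
    convert h using 1
    simp only [hVb_def, hI_def]; ring
  rw [oseenDuhamel_one_eq_setIntegral_oseenSlice]
  refine (norm_integral_le_of_norm_le hmi hptw).trans (le_of_eq ?_)
  rw [hm_def, integral_add (hPi.const_mul _) (hk.const_mul _), integral_const_mul, integral_const_mul,
    setIntegral_Ioo_sub_rpow_neg_half ht.le, ← Real.sqrt_eq_rpow, sub_zero]


/-! ### v1.8 — helpers for the dyadic-radius bootstrap -/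

/-- An a.e. bound of a continuous field on an open set holds everywhere there (Lebesgue measure
charges nonempty open sets; the tree's private `forall_norm_le_of_ae_norm_le_on`). [folklore] -/
theorem forall_norm_le_of_ae_norm_le_on'
    {f : EuclideanSpace ℝ (Fin 3) → EuclideanSpace ℝ (Fin 3)} (hf : Continuous f)
    {U : Set (EuclideanSpace ℝ (Fin 3))} (hU : IsOpen U) {b : ℝ}
    (h : ∀ᵐ x ∂(volume : Measure (EuclideanSpace ℝ (Fin 3))), x ∈ U → ‖f x‖ ≤ b) :
    ∀ x ∈ U, ‖f x‖ ≤ b := by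
  intro x hx
  by_contra hxb
  set V : Set (EuclideanSpace ℝ (Fin 3)) := U ∩ {y | b < ‖f y‖} with hV
  have hVo : IsOpen V := hU.inter (isOpen_lt continuous_const hf.norm)
  have hV0 : (volume : Measure (EuclideanSpace ℝ (Fin 3))) V = 0 := by
    refine measure_eq_zero_iff_ae_notMem.2 ?_
    filter_upwards [h] with y hy hyV
    exact absurd (hy hyV.1) (not_le.2 hyV.2)
  have hVe : V = ∅ := (hVo.measure_eq_zero_iff volume).1 hV0
  have hxV : x ∈ V := ⟨hx, not_le.1 hxb⟩
  rw [hVe] at hxV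
  exact hxV

/-- `∫_0^t (M/√(1−τ) + 1) dτ ≤ 2M + 1` for `0 < t < 1`, `M ≥ 0` (the Type-I rate is time-integrable
up to the singular time). [folklore] -/
theorem setIntegral_rate_le {M t : ℝ} (hM : 0 ≤ M) (ht : 0 < t) (ht1 : t < 1) :
    IntegrableOn (fun τ : ℝ => M / Real.sqrt (1 - τ) + 1) (Ioo 0 t) ∧ ∫ τ in Ioo 0 t, (M / Real.sqrt (1 - τ) + 1) ≤ 2 * M + 1 := by
  have hcont : ContinuousOn (fun τ : ℝ => M / Real.sqrt (1 - τ) + 1) (Icc 0 t) := by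
    refine ContinuousOn.add (ContinuousOn.div continuousOn_const
      ((continuousOn_const.sub continuousOn_id).sqrt) ?_) continuousOn_const
    intro τ hτ
    exact (Real.sqrt_pos.2 (by linarith [hτ.2])).ne'
  have hint : IntegrableOn (fun τ : ℝ => M / Real.sqrt (1 - τ) + 1) (Ioo 0 t) := (hcont.integrableOn_Icc).mono_set Ioo_subset_Icc_self
  refine ⟨hint, ?_⟩
  -- FTC with the primitive `F(τ) = -2M √(1-τ) + τ`
  have hderiv : ∀ τ ∈ uIcc 0 t, HasDerivAt (fun τ : ℝ => -(2 * M) * Real.sqrt (1 - τ) + τ) (M / Real.sqrt (1 - τ) + 1) τ := by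
    intro τ hτ
    rw [uIcc_of_le ht.le] at hτ
    have h1τ : 1 - τ ≠ 0 := by linarith [hτ.2]
    have hs : HasDerivAt (fun τ : ℝ => 1 - τ) (-1) τ := (hasDerivAt_id τ).const_sub 1
    have hsq := hs.sqrt h1τ
    have h := (hsq.const_mul (-(2 * M))).add (hasDerivAt_id τ)
    refine h.congr_deriv ?_
    have hpos : 0 < Real.sqrt (1 - τ) := Real.sqrt_pos.2 (by linarith [hτ.2])
    rw [div_eq_mul_inv, div_eq_mul_inv]
    field_simp
  rw [← integral_Ioc_eq_integral_Ioo, ← intervalIntegral.integral_of_le ht.le, intervalIntegral.integral_eq_sub_of_hasDerivAt hderiv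
      ((hcont.mono (by rw [uIcc_of_le ht.le])).intervalIntegrable)]
  have h0 : 0 ≤ Real.sqrt (1 - t) := Real.sqrt_nonneg _
  simp only [sub_zero, Real.sqrt_one, mul_one, add_zero]
  nlinarith

/-- `|B(0,R)| = R³ |B(0,1)|` in `ℝ³` (real-valued). [folklore] -/
theorem volume_real_ball_eq {R : ℝ} (hR : 0 ≤ R) :
    volume.real (Metric.ball (0 : EuclideanSpace ℝ (Fin 3)) R) = R ^ 3 * volume.real (Metric.ball (0 : EuclideanSpace ℝ (Fin 3)) 1) := by
  have h := Measure.addHaar_ball (volume : Measure (EuclideanSpace ℝ (Fin 3))) 0 hR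
  have hfr : Module.finrank ℝ (EuclideanSpace ℝ (Fin 3)) = 3 := by simp
  rw [hfr] at h
  simp only [Measure.real, h, ENNReal.toReal_mul, ENNReal.toReal_ofReal (pow_nonneg hR 3)]


end Summit.NavierStokesRegularity.NavierStokesRegularity.Cruxes.TypeIQuantSubcubicExp.TruncationEdge

end
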